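import Mathlib
import HarnessLib
import Literature.Analysis.FluidPDE.VorticityCalculus
import Literature.Analysis.FluidPDE.KinematicHubbleThreshold
import Summits.NavierStokesRegularity.NavierStokesRegularity.Theorems.UnthreadedDoorNetFluxDefs
import Summits.NavierStokesRegularity.NavierStokesRegularity.Theorems.UnthreadedDoorNetFluxOscLeVorticity

/-!
# Route `UnthreadedDoor`, crux `PoloidalLiouville` (stmt-NavierStokesRegularity-1222), WALL W1 `stub_scalarLiouville` —
# crux idea «netflux-typei-gap» (ns-idea-14): THE GROWTH CAP of the net flux density at the centre, `w(t,r) = O(r²)`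

KEY-NS #157 (2) (director-ns g16: interface-neutral pieces of the netflux toolkit while the line's v5 interface is being decided):
the a-priori size of the net flux density near the centre.  For a toroidal representation `curl v = ∇T × (x − x₀)` the vorticity
VANISHES at the centre (`ω(x₀) = ∇T(x₀) × 0 = 0`), so `‖ω‖ ≤ L·r` on `S_r(x₀)` when `‖Dω‖ ≤ L` on the closed ball (mean value
inequality), and NF-0 (`NetFlux.oscLeVorticity`, p660776) gives `osc_{S_r(x₀)} T ≤ π L r`, i.e. `netFlux T x₀ r = r · osc ≤ π L r²`
— the boundary behaviour `U(s,0) = 0`, `U = O(ρ²)` of the cumulative flux that NF-3 / NF-4 consume.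

* `NetFlux.cross_gradient_self_center` — `ω(x₀) = 0` for a toroidal representation;
* `NetFlux.norm_curl_le_mul_of_fderiv_le` — `‖ω(x)‖ ≤ L ‖x − x₀‖` on the closed ball;
* `NetFlux.netFlux_le_sq` — **`netFlux T x₀ r ≤ π · L · r²`**.

WHAT THIS IS NOT: no NS-regularity statement is touched; a SUPPORT inequality of one crux idea; `PoloidalLiouville` (1222), W1, the
line's rung target and the summit stay OPEN.  `--supports stmt-NavierStokesRegularity-1222 --as helper`.  [folklore]
-/

noncomputable section

-- the summit and its single sub-problem share the name (CONVENTIONS §1)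
set_option linter.dupNamespace false

open Set Function Filter Topology InnerProductSpace MeasureTheory
open scoped RealInnerProductSpace ContDiff

namespace Summit.NavierStokesRegularity.NavierStokesRegularity.Theorems.PoloidalLiouville.NetFlux

open Literature.Analysis Literature.Analysis.FluidPDE

/-- **A toroidal vorticity vanishes at the centre**: if `curl v = ∇T × (x − x₀)` everywhere then `curl v x₀ = 0`. [folklore] -/
theorem cross_gradient_self_center {v : E3 → E3} {x₀ : E3} {T : E3 → ℝ}
    (hrep : ∀ x, curl v x = cross (gradient T x) (x - x₀)) : curl v x₀ = 0 := by
  rw [hrep x₀, sub_self, cross_zero_right]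

/-- **`‖ω(x)‖ ≤ L ‖x − x₀‖` on the closed ball** when `ω(x₀) = 0`, `ω ∈ C¹` and `‖Dω‖ ≤ L` on `closedBall x₀ R` (mean value
inequality on the segment). [folklore] -/
theorem norm_curl_le_mul_of_fderiv_le {v : E3 → E3} {x₀ : E3} {R L : ℝ} (hv : ContDiff ℝ 2 v) (h0 : curl v x₀ = 0)
    (hL : ∀ x ∈ Metric.closedBall x₀ R, ‖fderiv ℝ (curl v) x‖ ≤ L) {x : E3} (hx : x ∈ Metric.closedBall x₀ R) :
    ‖curl v x‖ ≤ L * ‖x - x₀‖ := by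
  have hω : ContDiff ℝ 1 (curl v) := contDiff_curl (n := 1) (by exact_mod_cast hv)
  have hd : ∀ y ∈ Metric.closedBall x₀ R, DifferentiableAt ℝ (curl v) y := fun y _ =>
    (hω.differentiable one_ne_zero) y
  have hR : 0 ≤ R := le_trans dist_nonneg (Metric.mem_closedBall.1 hx)
  have h := (convex_closedBall x₀ R).norm_image_sub_le_of_norm_fderiv_le hd hL (Metric.mem_closedBall_self hR) hx
  rwa [h0, sub_zero] at h

/-- **The growth cap `w(r) ≤ π L r²`**: for `r > 0`, `v ∈ C²`, `T ∈ C¹` off `x₀` with `curl v = ∇T × (x − x₀)` and `‖D(curl v)‖ ≤ L` on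
`closedBall x₀ r`, the net flux density satisfies `netFlux T x₀ r ≤ π · L · r²` (NF-0 with `K = L r`). [folklore] -/
theorem netFlux_le_sq (v : E3 → E3) (x₀ : E3) (T : E3 → ℝ) {r L : ℝ} (hr : 0 < r) (hv : ContDiff ℝ 2 v)
    (hT : ContDiffOn ℝ 1 T ({x₀}ᶜ)) (hrep : ∀ x, curl v x = cross (gradient T x) (x - x₀))
    (hL : ∀ x ∈ Metric.closedBall x₀ r, ‖fderiv ℝ (curl v) x‖ ≤ L) :
    netFlux T x₀ r ≤ Real.pi * L * r ^ 2 := by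
  have hK : ∀ x ∈ Metric.sphere x₀ r, ‖curl v x‖ ≤ L * r := by
    intro x hx
    have h := norm_curl_le_mul_of_fderiv_le hv (cross_gradient_self_center hrep) hL (Metric.sphere_subset_closedBall hx)
    rwa [mem_sphere_iff_norm.1 hx] at h
  have hosc := oscLeVorticity v x₀ T r (L * r) hr (hv.of_le (by norm_num)) hT hrep hK
  unfold netFlux sphOsc sphSup sphInf
  have hr0 : 0 ≤ r := hr.le
  calc r * (sSup (T '' Metric.sphere x₀ r) - sInf (T '' Metric.sphere x₀ r)) ≤ r * (Real.pi * (L * r)) :=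
        mul_le_mul_of_nonneg_left hosc hr0
    _ = Real.pi * L * r ^ 2 := by ring

end Summit.NavierStokesRegularity.NavierStokesRegularity.Theorems.PoloidalLiouville.NetFlux

end
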